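import Summits.Parity.GeneralizedHardyLittlewood.Theorems.PrimeLevelFamEdgeMomentsBeyondDiagonalDiagRemFourFourKernelsNine
import Summits.Parity.GeneralizedHardyLittlewood.Theorems.PrimeLevelFamEdgeMomentsBeyondDiagonalDiagRemTwoFourKernelsAll
import HarnessLib

/-!
# Route `PrimeLevelFamEdge`, crux K_A `MomentsBeyondDiagonal` (stmt-Parity-20007), line «petersson_layers» v4, stub `stub_diag`:
# **all twenty-five remainder kernels of ORDER `(4,4)` under one constant (envelope exponent `10`), with the pointwise bounds of
# the fifteen both-sided ones (`a + b ≤ 4`)** (brick B4b of the remainder estimate (R₄₄); the order-`(4,4)` twin of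
# `…DiagRemTwoFourKernelsAll.twoSeq_fifteen₂₄` and `…DiagRemThreeThreeKernelsAll.twoSeq_sixteen₃₃`)

(R₄₄) — the remainder part `rem₄₄` of `…DiagDecorOrderFourFourSplit.selbergOrderFourFour_split` — carries the twenty-five continued Bose
remainders `r_ab`, `a, b ≤ 4`, in `Π`-form. They are collected here under ONE `C₀` from four landed bundles: the six both-sided kernels
of order `(3,3)` and `r₂₃, r₃₂, r₃₃` from `…KernelsAll.twoSeq_sixteen₃₃` (p834064; envelope `x⁸ ≤ x¹⁰`), `r₁₄, r₂₄` from
`…DiagRemTwoFourBose.abs_doubleSum_rem_le₂₄b` (p836792; `x⁸`), `r₃₄, r₄₁, r₄₂, r₄₃, r₄₄` from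
`…DiagRemFourFourBose.abs_doubleSum_rem_le₄₄b` (p838640; `x¹⁰`), and the nine kernels with `a + b ∈ {3,4}` WITH their pointwise bounds
from `…DiagRemFourFourKernelsNine.twoSeq_nine₄₄` (this lineage).

* `twoSeq_envelope_mono_pow` — the envelope `9C'xᵐ` is below `9Cxⁿ` for `1 ≤ x`, `C' ≤ C`, `m ≤ n`;
* `twoSeq_twentyfive₄₄` — **all twenty-five kernels of (R₄₄) under ONE `C₀` (two-sequence Abel estimate, envelope
  `9C₀(1+|log 2αY²|)¹⁰`) and, with the same `E_ab`, the pointwise bounds `|r_ab(y)| ≤ C₀√y` (`0 < y ≤ 1`), `|r_ab(y)| ≤ C₀(1+log y)⁵`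
  (`y ≥ 1`) of the fifteen both-sided kernels `r_ab`, `a + b ≤ 4`** — the kernel input of the inner estimate of (R₄₄).

Def-free; theorems only. Helper `--supports stmt-Parity-20007`; closes nothing (bricks B3–B5 of (R₄₄), the polynomial side of order
`(4,4)` and `stub_rung/core/band/farP` remain); K_A, K_B and the Parity summit are NOT proved; nothing about Landau–Siegel zeros.

## References
* E. Kowalski, P. Michel, J. VanderKam, J. reine angew. Math. 526 (2000), (22)–(28) pp. 12–15 and Prop. 5.1 p. 18.
  [cite: KowalskiMichelVanderKam2000, (23)–(28) and Prop. 5.1 — derivation (order-(4,4) remainder, inner sums)]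
-/

noncomputable section

open Real MeasureTheory Finset

namespace Summit.Parity.GeneralizedHardyLittlewood.Theorems.MomentsBeyondDiagonal.DiagCorner

open Summit.Parity.GeneralizedHardyLittlewood.Theorems.BeyondDiagonalBeatsQuarter.Corner
open Summit.Parity.GeneralizedHardyLittlewood.Theorems.MomentsBeyondDiagonal.DiagLines

/-- Monotonicity of the two-sequence envelope in the constant and the exponent (`1 ≤ x`, `C' ≤ C`, `m ≤ n`). [folklore] -/
theorem twoSeq_envelope_mono_pow {S₁ S₂ B η Li Lj s x C' C v : ℝ} {m n : ℕ} (hS₁ : 0 ≤ S₁) (hS₂ : 0 ≤ S₂) (hB : 0 ≤ B)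
    (hη : 0 ≤ η) (hLi : 0 ≤ Li) (hLj : 0 ≤ Lj) (hs : 0 ≤ s) (hx : 1 ≤ x) (hC'0 : 0 ≤ C') (hC : C' ≤ C) (hmn : m ≤ n)
    (hv : v ≤ S₁ * (B * (Lj * (3 * C' * s))) + S₂ * ((2 * η) * (Li * (9 * C' * x ^ m)))) :
    v ≤ S₁ * (B * (Lj * (3 * C * s))) + S₂ * ((2 * η) * (Li * (9 * C * x ^ n))) := by
  have hx0 : 0 ≤ x := zero_le_one.trans hx
  have hxn : 0 ≤ x ^ n := pow_nonneg hx0 n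
  have hxmn : x ^ m ≤ x ^ n := pow_le_pow_right₀ hx hmn
  have e1 : 3 * C' * s ≤ 3 * C * s := by nlinarith
  have e2 : 9 * C' * x ^ m ≤ 9 * C * x ^ n := by nlinarith [mul_le_mul_of_nonneg_left hxmn hC'0]
  refine hv.trans (add_le_add ?_ ?_)
  · exact mul_le_mul_of_nonneg_left (mul_le_mul_of_nonneg_left (mul_le_mul_of_nonneg_left e1 hLj) hB) hS₁
  · exact mul_le_mul_of_nonneg_left (mul_le_mul_of_nonneg_left (mul_le_mul_of_nonneg_left e2 hLi)
      (by positivity)) hS₂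

set_option maxHeartbeats 3200000 in
set_option maxRecDepth 8192 in
-- twenty-five kernels, large statement
/-- **All twenty-five remainder kernels of order `(4,4)` under one constant, with the pointwise bounds of the fifteen both-sided ones**
(module docstring). [cite: KowalskiMichelVanderKam2000, (23)–(28) and Prop. 5.1 — derivation (order-(4,4) remainder, inner sums)] -/
theorem twoSeq_twentyfive₄₄ : ∃ E₀₀ E₀₁ E₀₂ E₀₃ E₀₄ E₁₀ E₁₁ E₁₂ E₁₃ E₁₄ E₂₀ E₂₁ E₂₂ E₂₃ E₂₄ E₃₀ E₃₁ E₃₂ E₃₃ E₃₄ E₄₀ E₄₁ E₄₂ E₄₃ E₄₄ C₀ : ℝ, 0 ≤ C₀ ∧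
    (∀ R : ℝ → ℝ,
      (R = (fun y : ℝ ↦ (∫ u₁ in Set.Ioi (0 : ℝ), ∫ u₂ in Set.Ioi (y / u₁), Real.exp (-(u₁ + u₂)) / (1 - Real.exp (-(u₁ + u₂))) ^ 2) -
            (Real.log (1 / y) / 2 + E₀₀)) ∨
       R = (fun y : ℝ ↦ (∫ u₁ in Set.Ioi (0 : ℝ), ∫ u₂ in Set.Ioi (y / u₁), Real.exp (-(u₁ + u₂)) / (1 - Real.exp (-(u₁ + u₂))) ^ 2 * Real.log u₂) -
            (-(Real.log (1 / y) ^ 2) / 8 + E₀₁)) ∨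
       R = (fun y : ℝ ↦ (∫ u₁ in Set.Ioi (0 : ℝ), ∫ u₂ in Set.Ioi (y / u₁), Real.exp (-(u₁ + u₂)) / (1 - Real.exp (-(u₁ + u₂))) ^ 2 * Real.log u₂ ^ 2) -
            (Real.log (1 / y) ^ 3 / 24 + 2 * (∫ v in Set.Ioc (0 : ℝ) 1, Real.log v ^ 2 * (v / (1 + v ^ 2) ^ 2)) * Real.log (1 / y) + E₀₂)) ∨
       R = (fun y : ℝ ↦ (∫ u₁ in Set.Ioi (0 : ℝ), ∫ u₂ in Set.Ioi (y / u₁), Real.exp (-(u₁ + u₂)) / (1 - Real.exp (-(u₁ + u₂))) ^ 2 * Real.log u₂ ^ 3) -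
            (-(Real.log (1 / y) ^ 4) / 64 - 3 * (∫ v in Set.Ioc (0 : ℝ) 1, Real.log v ^ 2 * (v / (1 + v ^ 2) ^ 2)) / 2 * Real.log (1 / y) ^ 2 + E₀₃)) ∨
       R = (fun y : ℝ ↦ (∫ u₁ in Set.Ioi (0 : ℝ), ∫ u₂ in Set.Ioi (y / u₁), Real.exp (-(u₁ + u₂)) / (1 - Real.exp (-(u₁ + u₂))) ^ 2 * Real.log u₂ ^ 4) -
            (Real.log (1 / y) ^ 5 / 160 + (∫ v in Set.Ioc (0 : ℝ) 1, Real.log v ^ 2 * (v / (1 + v ^ 2) ^ 2)) * Real.log (1 / y) ^ 3 + 2 * (∫ v in Set.Ioc (0 : ℝ) 1, Real.log v ^ 4 * (v / (1 + v ^ 2) ^ 2)) * Real.log (1 / y) + E₀₄)) ∨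
       R = (fun y : ℝ ↦ (∫ u₁ in Set.Ioi (0 : ℝ), Real.log u₁ * ∫ u₂ in Set.Ioi (y / u₁), Real.exp (-(u₁ + u₂)) / (1 - Real.exp (-(u₁ + u₂))) ^ 2) -
            (-(Real.log (1 / y) ^ 2) / 8 + E₁₀)) ∨
       R = (fun y : ℝ ↦ (∫ u₁ in Set.Ioi (0 : ℝ), Real.log u₁ * ∫ u₂ in Set.Ioi (y / u₁), Real.exp (-(u₁ + u₂)) / (1 - Real.exp (-(u₁ + u₂))) ^ 2 * Real.log u₂) -
            (Real.log (1 / y) ^ 3 / 24 - 2 * (∫ v in Set.Ioc (0 : ℝ) 1, Real.log v ^ 2 * (v / (1 + v ^ 2) ^ 2)) * Real.log (1 / y) + E₁₁)) ∨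
       R = (fun y : ℝ ↦ (∫ u₁ in Set.Ioi (0 : ℝ), Real.log u₁ * ∫ u₂ in Set.Ioi (y / u₁), Real.exp (-(u₁ + u₂)) / (1 - Real.exp (-(u₁ + u₂))) ^ 2 * Real.log u₂ ^ 2) -
            (-(Real.log (1 / y) ^ 4) / 64 + (∫ v in Set.Ioc (0 : ℝ) 1, Real.log v ^ 2 * (v / (1 + v ^ 2) ^ 2)) / 2 * Real.log (1 / y) ^ 2 + E₁₂)) ∨
       R = (fun y : ℝ ↦ (∫ u₁ in Set.Ioi (0 : ℝ), Real.log u₁ * ∫ u₂ in Set.Ioi (y / u₁), Real.exp (-(u₁ + u₂)) / (1 - Real.exp (-(u₁ + u₂))) ^ 2 * Real.log u₂ ^ 3) -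
            (Real.log (1 / y) ^ 5 / 160 - 2 * (∫ v in Set.Ioc (0 : ℝ) 1, Real.log v ^ 4 * (v / (1 + v ^ 2) ^ 2)) * Real.log (1 / y) + E₁₃)) ∨
       R = (fun y : ℝ ↦ (∫ u₁ in Set.Ioi (0 : ℝ), Real.log u₁ * ∫ u₂ in Set.Ioi (y / u₁), Real.exp (-(u₁ + u₂)) / (1 - Real.exp (-(u₁ + u₂))) ^ 2 * Real.log u₂ ^ 4) -
            (-(Real.log (1 / y) ^ 6) / 384 - (∫ v in Set.Ioc (0 : ℝ) 1, Real.log v ^ 2 * (v / (1 + v ^ 2) ^ 2)) / 8 * Real.log (1 / y) ^ 4 + 3 * (∫ v in Set.Ioc (0 : ℝ) 1, Real.log v ^ 4 * (v / (1 + v ^ 2) ^ 2)) / 2 * Real.log (1 / y) ^ 2 + E₁₄)) ∨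
       R = (fun y : ℝ ↦ (∫ u₁ in Set.Ioi (0 : ℝ), Real.log u₁ ^ 2 * ∫ u₂ in Set.Ioi (y / u₁), Real.exp (-(u₁ + u₂)) / (1 - Real.exp (-(u₁ + u₂))) ^ 2) -
            (Real.log (1 / y) ^ 3 / 24 + 2 * (∫ v in Set.Ioc (0 : ℝ) 1, Real.log v ^ 2 * (v / (1 + v ^ 2) ^ 2)) * Real.log (1 / y) + E₂₀)) ∨
       R = (fun y : ℝ ↦ (∫ u₁ in Set.Ioi (0 : ℝ), Real.log u₁ ^ 2 * ∫ u₂ in Set.Ioi (y / u₁), Real.exp (-(u₁ + u₂)) / (1 - Real.exp (-(u₁ + u₂))) ^ 2 * Real.log u₂) -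
            (-(Real.log (1 / y) ^ 4) / 64 + (∫ v in Set.Ioc (0 : ℝ) 1, Real.log v ^ 2 * (v / (1 + v ^ 2) ^ 2)) / 2 * Real.log (1 / y) ^ 2 + E₂₁)) ∨
       R = (fun y : ℝ ↦ (∫ u₁ in Set.Ioi (0 : ℝ), Real.log u₁ ^ 2 * ∫ u₂ in Set.Ioi (y / u₁), Real.exp (-(u₁ + u₂)) / (1 - Real.exp (-(u₁ + u₂))) ^ 2 * Real.log u₂ ^ 2) -
            (Real.log (1 / y) ^ 5 / 160 - (∫ v in Set.Ioc (0 : ℝ) 1, Real.log v ^ 2 * (v / (1 + v ^ 2) ^ 2)) / 3 * Real.log (1 / y) ^ 3 + 2 * (∫ v in Set.Ioc (0 : ℝ) 1, Real.log v ^ 4 * (v / (1 + v ^ 2) ^ 2)) * Real.log (1 / y) + E₂₂)) ∨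
       R = (fun y : ℝ ↦ (∫ u₁ in Set.Ioi (0 : ℝ), Real.log u₁ ^ 2 * ∫ u₂ in Set.Ioi (y / u₁), Real.exp (-(u₁ + u₂)) / (1 - Real.exp (-(u₁ + u₂))) ^ 2 * Real.log u₂ ^ 3) -
            (-(Real.log (1 / y) ^ 6) / 384 + (∫ v in Set.Ioc (0 : ℝ) 1, Real.log v ^ 2 * (v / (1 + v ^ 2) ^ 2)) / 8 * Real.log (1 / y) ^ 4 - (∫ v in Set.Ioc (0 : ℝ) 1, Real.log v ^ 4 * (v / (1 + v ^ 2) ^ 2)) / 2 * Real.log (1 / y) ^ 2 + E₂₃)) ∨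
       R = (fun y : ℝ ↦ (∫ u₁ in Set.Ioi (0 : ℝ), Real.log u₁ ^ 2 * ∫ u₂ in Set.Ioi (y / u₁), Real.exp (-(u₁ + u₂)) / (1 - Real.exp (-(u₁ + u₂))) ^ 2 * Real.log u₂ ^ 4) -
            (Real.log (1 / y) ^ 7 / 896 - (∫ v in Set.Ioc (0 : ℝ) 1, Real.log v ^ 2 * (v / (1 + v ^ 2) ^ 2)) / 40 * Real.log (1 / y) ^ 5 - (∫ v in Set.Ioc (0 : ℝ) 1, Real.log v ^ 4 * (v / (1 + v ^ 2) ^ 2)) / 6 * Real.log (1 / y) ^ 3 + 2 * (∫ v in Set.Ioc (0 : ℝ) 1, Real.log v ^ 6 * (v / (1 + v ^ 2) ^ 2)) * Real.log (1 / y) + E₂₄)) ∨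
       R = (fun y : ℝ ↦ (∫ u₁ in Set.Ioi (0 : ℝ), Real.log u₁ ^ 3 * ∫ u₂ in Set.Ioi (y / u₁), Real.exp (-(u₁ + u₂)) / (1 - Real.exp (-(u₁ + u₂))) ^ 2) -
            (-(Real.log (1 / y) ^ 4) / 64 - 3 * (∫ v in Set.Ioc (0 : ℝ) 1, Real.log v ^ 2 * (v / (1 + v ^ 2) ^ 2)) / 2 * Real.log (1 / y) ^ 2 + E₃₀)) ∨
       R = (fun y : ℝ ↦ (∫ u₁ in Set.Ioi (0 : ℝ), Real.log u₁ ^ 3 * ∫ u₂ in Set.Ioi (y / u₁), Real.exp (-(u₁ + u₂)) / (1 - Real.exp (-(u₁ + u₂))) ^ 2 * Real.log u₂) -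
            (Real.log (1 / y) ^ 5 / 160 - 2 * (∫ v in Set.Ioc (0 : ℝ) 1, Real.log v ^ 4 * (v / (1 + v ^ 2) ^ 2)) * Real.log (1 / y) + E₃₁)) ∨
       R = (fun y : ℝ ↦ (∫ u₁ in Set.Ioi (0 : ℝ), Real.log u₁ ^ 3 * ∫ u₂ in Set.Ioi (y / u₁), Real.exp (-(u₁ + u₂)) / (1 - Real.exp (-(u₁ + u₂))) ^ 2 * Real.log u₂ ^ 2) -
            (-(Real.log (1 / y) ^ 6) / 384 + (∫ v in Set.Ioc (0 : ℝ) 1, Real.log v ^ 2 * (v / (1 + v ^ 2) ^ 2)) / 8 * Real.log (1 / y) ^ 4 - (∫ v in Set.Ioc (0 : ℝ) 1, Real.log v ^ 4 * (v / (1 + v ^ 2) ^ 2)) / 2 * Real.log (1 / y) ^ 2 + E₃₂)) ∨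
       R = (fun y : ℝ ↦ (∫ u₁ in Set.Ioi (0 : ℝ), Real.log u₁ ^ 3 * ∫ u₂ in Set.Ioi (y / u₁), Real.exp (-(u₁ + u₂)) / (1 - Real.exp (-(u₁ + u₂))) ^ 2 * Real.log u₂ ^ 3) -
            (Real.log (1 / y) ^ 7 / 896 - 3 * (∫ v in Set.Ioc (0 : ℝ) 1, Real.log v ^ 2 * (v / (1 + v ^ 2) ^ 2)) / 40 * Real.log (1 / y) ^ 5 + (∫ v in Set.Ioc (0 : ℝ) 1, Real.log v ^ 4 * (v / (1 + v ^ 2) ^ 2)) / 2 * Real.log (1 / y) ^ 3 - 2 * (∫ v in Set.Ioc (0 : ℝ) 1, Real.log v ^ 6 * (v / (1 + v ^ 2) ^ 2)) * Real.log (1 / y) + E₃₃)) ∨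
       R = (fun y : ℝ ↦ (∫ u₁ in Set.Ioi (0 : ℝ), Real.log u₁ ^ 3 * ∫ u₂ in Set.Ioi (y / u₁), Real.exp (-(u₁ + u₂)) / (1 - Real.exp (-(u₁ + u₂))) ^ 2 * Real.log u₂ ^ 4) -
            (-(Real.log (1 / y) ^ 8) / 2048 + (∫ v in Set.Ioc (0 : ℝ) 1, Real.log v ^ 2 * (v / (1 + v ^ 2) ^ 2)) / 32 * Real.log (1 / y) ^ 6 - 3 * (∫ v in Set.Ioc (0 : ℝ) 1, Real.log v ^ 4 * (v / (1 + v ^ 2) ^ 2)) / 16 * Real.log (1 / y) ^ 4 + (∫ v in Set.Ioc (0 : ℝ) 1, Real.log v ^ 6 * (v / (1 + v ^ 2) ^ 2)) / 2 * Real.log (1 / y) ^ 2 + E₃₄)) ∨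
       R = (fun y : ℝ ↦ (∫ u₁ in Set.Ioi (0 : ℝ), Real.log u₁ ^ 4 * ∫ u₂ in Set.Ioi (y / u₁), Real.exp (-(u₁ + u₂)) / (1 - Real.exp (-(u₁ + u₂))) ^ 2) -
            (Real.log (1 / y) ^ 5 / 160 + (∫ v in Set.Ioc (0 : ℝ) 1, Real.log v ^ 2 * (v / (1 + v ^ 2) ^ 2)) * Real.log (1 / y) ^ 3 + 2 * (∫ v in Set.Ioc (0 : ℝ) 1, Real.log v ^ 4 * (v / (1 + v ^ 2) ^ 2)) * Real.log (1 / y) + E₄₀)) ∨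
       R = (fun y : ℝ ↦ (∫ u₁ in Set.Ioi (0 : ℝ), Real.log u₁ ^ 4 * ∫ u₂ in Set.Ioi (y / u₁), Real.exp (-(u₁ + u₂)) / (1 - Real.exp (-(u₁ + u₂))) ^ 2 * Real.log u₂) -
            (-(Real.log (1 / y) ^ 6) / 384 - (∫ v in Set.Ioc (0 : ℝ) 1, Real.log v ^ 2 * (v / (1 + v ^ 2) ^ 2)) / 8 * Real.log (1 / y) ^ 4 + 3 * (∫ v in Set.Ioc (0 : ℝ) 1, Real.log v ^ 4 * (v / (1 + v ^ 2) ^ 2)) / 2 * Real.log (1 / y) ^ 2 + E₄₁)) ∨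
       R = (fun y : ℝ ↦ (∫ u₁ in Set.Ioi (0 : ℝ), Real.log u₁ ^ 4 * ∫ u₂ in Set.Ioi (y / u₁), Real.exp (-(u₁ + u₂)) / (1 - Real.exp (-(u₁ + u₂))) ^ 2 * Real.log u₂ ^ 2) -
            (Real.log (1 / y) ^ 7 / 896 - (∫ v in Set.Ioc (0 : ℝ) 1, Real.log v ^ 2 * (v / (1 + v ^ 2) ^ 2)) / 40 * Real.log (1 / y) ^ 5 - (∫ v in Set.Ioc (0 : ℝ) 1, Real.log v ^ 4 * (v / (1 + v ^ 2) ^ 2)) / 6 * Real.log (1 / y) ^ 3 + 2 * (∫ v in Set.Ioc (0 : ℝ) 1, Real.log v ^ 6 * (v / (1 + v ^ 2) ^ 2)) * Real.log (1 / y) + E₄₂)) ∨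
       R = (fun y : ℝ ↦ (∫ u₁ in Set.Ioi (0 : ℝ), Real.log u₁ ^ 4 * ∫ u₂ in Set.Ioi (y / u₁), Real.exp (-(u₁ + u₂)) / (1 - Real.exp (-(u₁ + u₂))) ^ 2 * Real.log u₂ ^ 3) -
            (-(Real.log (1 / y) ^ 8) / 2048 + (∫ v in Set.Ioc (0 : ℝ) 1, Real.log v ^ 2 * (v / (1 + v ^ 2) ^ 2)) / 32 * Real.log (1 / y) ^ 6 - 3 * (∫ v in Set.Ioc (0 : ℝ) 1, Real.log v ^ 4 * (v / (1 + v ^ 2) ^ 2)) / 16 * Real.log (1 / y) ^ 4 + (∫ v in Set.Ioc (0 : ℝ) 1, Real.log v ^ 6 * (v / (1 + v ^ 2) ^ 2)) / 2 * Real.log (1 / y) ^ 2 + E₄₃)) ∨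
       R = (fun y : ℝ ↦ (∫ u₁ in Set.Ioi (0 : ℝ), Real.log u₁ ^ 4 * ∫ u₂ in Set.Ioi (y / u₁), Real.exp (-(u₁ + u₂)) / (1 - Real.exp (-(u₁ + u₂))) ^ 2 * Real.log u₂ ^ 4) -
            (Real.log (1 / y) ^ 9 / 4608 - (∫ v in Set.Ioc (0 : ℝ) 1, Real.log v ^ 2 * (v / (1 + v ^ 2) ^ 2)) / 56 * Real.log (1 / y) ^ 7 + 3 * (∫ v in Set.Ioc (0 : ℝ) 1, Real.log v ^ 4 * (v / (1 + v ^ 2) ^ 2)) / 20 * Real.log (1 / y) ^ 5 - 2 * (∫ v in Set.Ioc (0 : ℝ) 1, Real.log v ^ 6 * (v / (1 + v ^ 2) ^ 2)) / 3 * Real.log (1 / y) ^ 3 + 2 * (∫ v in Set.Ioc (0 : ℝ) 1, Real.log v ^ 8 * (v / (1 + v ^ 2) ^ 2)) * Real.log (1 / y) + E₄₄))) →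
      ∀ (a₁ a₂ : ℕ → ℝ) (Y α B η : ℝ) (K₁ i j : ℕ), 1 ≤ Y → 0 < α → 1 ≤ i → 1 ≤ j →
        (∀ e : ℕ, e ≤ ⌊Y⌋₊ → |∑ k ∈ Icc 1 e, a₂ k| ≤ B) → (∀ e : ℕ, K₁ ≤ e → |∑ k ∈ Icc 1 e, a₁ k| ≤ η) →
        2 * α * K₁ * Y ≤ 1 →
      |∑ k₁ ∈ Icc 1 ⌊Y⌋₊, ∑ k₂ ∈ Icc 1 ⌊Y⌋₊,
          a₁ k₁ * a₂ k₂ * ellp Y k₁ ^ i * ellp Y k₂ ^ j * R (α * k₁ * k₂)| ≤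
        (∑ k ∈ Icc 1 ⌊Y⌋₊, |a₁ k| * ellp Y k ^ i) * (B * (Real.log Y ^ j * (3 * C₀ * Real.sqrt (2 * α * K₁ * Y)))) +
          (∑ k ∈ Icc 1 ⌊Y⌋₊, |a₂ k| * ellp Y k ^ j) *
            ((2 * η) * (Real.log Y ^ i * (9 * C₀ * (1 + |Real.log (2 * α * Y ^ 2)|) ^ 10)))) ∧
    (∀ R : ℝ → ℝ,
      (R = (fun y : ℝ ↦ (∫ u₁ in Set.Ioi (0 : ℝ), ∫ u₂ in Set.Ioi (y / u₁), Real.exp (-(u₁ + u₂)) / (1 - Real.exp (-(u₁ + u₂))) ^ 2) -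
            (Real.log (1 / y) / 2 + E₀₀)) ∨
       R = (fun y : ℝ ↦ (∫ u₁ in Set.Ioi (0 : ℝ), ∫ u₂ in Set.Ioi (y / u₁), Real.exp (-(u₁ + u₂)) / (1 - Real.exp (-(u₁ + u₂))) ^ 2 * Real.log u₂) -
            (-(Real.log (1 / y) ^ 2) / 8 + E₀₁)) ∨
       R = (fun y : ℝ ↦ (∫ u₁ in Set.Ioi (0 : ℝ), ∫ u₂ in Set.Ioi (y / u₁), Real.exp (-(u₁ + u₂)) / (1 - Real.exp (-(u₁ + u₂))) ^ 2 * Real.log u₂ ^ 2) -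
            (Real.log (1 / y) ^ 3 / 24 + 2 * (∫ v in Set.Ioc (0 : ℝ) 1, Real.log v ^ 2 * (v / (1 + v ^ 2) ^ 2)) * Real.log (1 / y) + E₀₂)) ∨
       R = (fun y : ℝ ↦ (∫ u₁ in Set.Ioi (0 : ℝ), ∫ u₂ in Set.Ioi (y / u₁), Real.exp (-(u₁ + u₂)) / (1 - Real.exp (-(u₁ + u₂))) ^ 2 * Real.log u₂ ^ 3) -
            (-(Real.log (1 / y) ^ 4) / 64 - 3 * (∫ v in Set.Ioc (0 : ℝ) 1, Real.log v ^ 2 * (v / (1 + v ^ 2) ^ 2)) / 2 * Real.log (1 / y) ^ 2 + E₀₃)) ∨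
       R = (fun y : ℝ ↦ (∫ u₁ in Set.Ioi (0 : ℝ), ∫ u₂ in Set.Ioi (y / u₁), Real.exp (-(u₁ + u₂)) / (1 - Real.exp (-(u₁ + u₂))) ^ 2 * Real.log u₂ ^ 4) -
            (Real.log (1 / y) ^ 5 / 160 + (∫ v in Set.Ioc (0 : ℝ) 1, Real.log v ^ 2 * (v / (1 + v ^ 2) ^ 2)) * Real.log (1 / y) ^ 3 + 2 * (∫ v in Set.Ioc (0 : ℝ) 1, Real.log v ^ 4 * (v / (1 + v ^ 2) ^ 2)) * Real.log (1 / y) + E₀₄)) ∨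
       R = (fun y : ℝ ↦ (∫ u₁ in Set.Ioi (0 : ℝ), Real.log u₁ * ∫ u₂ in Set.Ioi (y / u₁), Real.exp (-(u₁ + u₂)) / (1 - Real.exp (-(u₁ + u₂))) ^ 2) -
            (-(Real.log (1 / y) ^ 2) / 8 + E₁₀)) ∨
       R = (fun y : ℝ ↦ (∫ u₁ in Set.Ioi (0 : ℝ), Real.log u₁ * ∫ u₂ in Set.Ioi (y / u₁), Real.exp (-(u₁ + u₂)) / (1 - Real.exp (-(u₁ + u₂))) ^ 2 * Real.log u₂) -
            (Real.log (1 / y) ^ 3 / 24 - 2 * (∫ v in Set.Ioc (0 : ℝ) 1, Real.log v ^ 2 * (v / (1 + v ^ 2) ^ 2)) * Real.log (1 / y) + E₁₁)) ∨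
       R = (fun y : ℝ ↦ (∫ u₁ in Set.Ioi (0 : ℝ), Real.log u₁ * ∫ u₂ in Set.Ioi (y / u₁), Real.exp (-(u₁ + u₂)) / (1 - Real.exp (-(u₁ + u₂))) ^ 2 * Real.log u₂ ^ 2) -
            (-(Real.log (1 / y) ^ 4) / 64 + (∫ v in Set.Ioc (0 : ℝ) 1, Real.log v ^ 2 * (v / (1 + v ^ 2) ^ 2)) / 2 * Real.log (1 / y) ^ 2 + E₁₂)) ∨
       R = (fun y : ℝ ↦ (∫ u₁ in Set.Ioi (0 : ℝ), Real.log u₁ * ∫ u₂ in Set.Ioi (y / u₁), Real.exp (-(u₁ + u₂)) / (1 - Real.exp (-(u₁ + u₂))) ^ 2 * Real.log u₂ ^ 3) -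
            (Real.log (1 / y) ^ 5 / 160 - 2 * (∫ v in Set.Ioc (0 : ℝ) 1, Real.log v ^ 4 * (v / (1 + v ^ 2) ^ 2)) * Real.log (1 / y) + E₁₃)) ∨
       R = (fun y : ℝ ↦ (∫ u₁ in Set.Ioi (0 : ℝ), Real.log u₁ ^ 2 * ∫ u₂ in Set.Ioi (y / u₁), Real.exp (-(u₁ + u₂)) / (1 - Real.exp (-(u₁ + u₂))) ^ 2) -
            (Real.log (1 / y) ^ 3 / 24 + 2 * (∫ v in Set.Ioc (0 : ℝ) 1, Real.log v ^ 2 * (v / (1 + v ^ 2) ^ 2)) * Real.log (1 / y) + E₂₀)) ∨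
       R = (fun y : ℝ ↦ (∫ u₁ in Set.Ioi (0 : ℝ), Real.log u₁ ^ 2 * ∫ u₂ in Set.Ioi (y / u₁), Real.exp (-(u₁ + u₂)) / (1 - Real.exp (-(u₁ + u₂))) ^ 2 * Real.log u₂) -
            (-(Real.log (1 / y) ^ 4) / 64 + (∫ v in Set.Ioc (0 : ℝ) 1, Real.log v ^ 2 * (v / (1 + v ^ 2) ^ 2)) / 2 * Real.log (1 / y) ^ 2 + E₂₁)) ∨
       R = (fun y : ℝ ↦ (∫ u₁ in Set.Ioi (0 : ℝ), Real.log u₁ ^ 2 * ∫ u₂ in Set.Ioi (y / u₁), Real.exp (-(u₁ + u₂)) / (1 - Real.exp (-(u₁ + u₂))) ^ 2 * Real.log u₂ ^ 2) -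
            (Real.log (1 / y) ^ 5 / 160 - (∫ v in Set.Ioc (0 : ℝ) 1, Real.log v ^ 2 * (v / (1 + v ^ 2) ^ 2)) / 3 * Real.log (1 / y) ^ 3 + 2 * (∫ v in Set.Ioc (0 : ℝ) 1, Real.log v ^ 4 * (v / (1 + v ^ 2) ^ 2)) * Real.log (1 / y) + E₂₂)) ∨
       R = (fun y : ℝ ↦ (∫ u₁ in Set.Ioi (0 : ℝ), Real.log u₁ ^ 3 * ∫ u₂ in Set.Ioi (y / u₁), Real.exp (-(u₁ + u₂)) / (1 - Real.exp (-(u₁ + u₂))) ^ 2) -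
            (-(Real.log (1 / y) ^ 4) / 64 - 3 * (∫ v in Set.Ioc (0 : ℝ) 1, Real.log v ^ 2 * (v / (1 + v ^ 2) ^ 2)) / 2 * Real.log (1 / y) ^ 2 + E₃₀)) ∨
       R = (fun y : ℝ ↦ (∫ u₁ in Set.Ioi (0 : ℝ), Real.log u₁ ^ 3 * ∫ u₂ in Set.Ioi (y / u₁), Real.exp (-(u₁ + u₂)) / (1 - Real.exp (-(u₁ + u₂))) ^ 2 * Real.log u₂) -
            (Real.log (1 / y) ^ 5 / 160 - 2 * (∫ v in Set.Ioc (0 : ℝ) 1, Real.log v ^ 4 * (v / (1 + v ^ 2) ^ 2)) * Real.log (1 / y) + E₃₁)) ∨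
       R = (fun y : ℝ ↦ (∫ u₁ in Set.Ioi (0 : ℝ), Real.log u₁ ^ 4 * ∫ u₂ in Set.Ioi (y / u₁), Real.exp (-(u₁ + u₂)) / (1 - Real.exp (-(u₁ + u₂))) ^ 2) -
            (Real.log (1 / y) ^ 5 / 160 + (∫ v in Set.Ioc (0 : ℝ) 1, Real.log v ^ 2 * (v / (1 + v ^ 2) ^ 2)) * Real.log (1 / y) ^ 3 + 2 * (∫ v in Set.Ioc (0 : ℝ) 1, Real.log v ^ 4 * (v / (1 + v ^ 2) ^ 2)) * Real.log (1 / y) + E₄₀))) →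
      (∀ y : ℝ, 0 < y → y ≤ 1 → |R y| ≤ C₀ * Real.sqrt y) ∧ (∀ y : ℝ, 1 ≤ y → |R y| ≤ C₀ * (1 + Real.log y) ^ 5)) := by
  obtain ⟨E₀₀, E₀₁, E₀₂, _, E₁₀, E₁₁, _, _, E₂₀, _, _, E₂₃, _, _, E₃₂, E₃₃, C₀a, hC₀a, hTa, hPWa⟩ :=
    twoSeq_sixteen₃₃
  obtain ⟨E₁₄, E₂₄, C₀c, hC₀c, hTc⟩ := abs_doubleSum_rem_le₂₄b
  obtain ⟨E₃₄, _, E₄₁, E₄₂, E₄₃, E₄₄, C₀d, hC₀d, hTd⟩ := abs_doubleSum_rem_le₄₄b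
  obtain ⟨E₀₃, E₁₂, E₂₁, E₃₀, E₀₄, E₁₃, E₂₂, E₃₁, E₄₀, C₀n, hC₀n, hTn, hPWn⟩ := twoSeq_nine₄₄
  set C₀ : ℝ := max (max (max C₀a C₀c) C₀d) C₀n with hC₀def
  have ea : C₀a ≤ C₀ := ((le_max_left _ _).trans (le_max_left _ _)).trans (le_max_left _ _)
  have ec : C₀c ≤ C₀ := ((le_max_right _ _).trans (le_max_left _ _)).trans (le_max_left _ _)
  have ed : C₀d ≤ C₀ := (le_max_right _ _).trans (le_max_left _ _)
  have en : C₀n ≤ C₀ := le_max_right _ _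
  have hC₀ : 0 ≤ C₀ := hC₀a.trans ea
  refine ⟨E₀₀, E₀₁, E₀₂, E₀₃, E₀₄, E₁₀, E₁₁, E₁₂, E₁₃, E₁₄, E₂₀, E₂₁, E₂₂, E₂₃, E₂₄, E₃₀, E₃₁, E₃₂, E₃₃, E₃₄, E₄₀, E₄₁, E₄₂, E₄₃, E₄₄, C₀, hC₀, ?_, ?_⟩
  · intro R hRR a₁ a₂ Y α B η K₁ i j hY hα hi hj hcol hrow hY₁
    have hLY0 : 0 ≤ Real.log Y := Real.log_nonneg hY
    have hB0 : 0 ≤ B := (abs_nonneg _).trans (hcol 0 (Nat.zero_le _))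
    have hη0 : 0 ≤ η := (abs_nonneg _).trans (hrow K₁ le_rfl)
    have hS₁ : 0 ≤ ∑ k ∈ Icc 1 ⌊Y⌋₊, |a₁ k| * ellp Y k ^ i :=
      Finset.sum_nonneg fun k _ ↦ mul_nonneg (abs_nonneg _) (pow_nonneg (ellp_nonneg Y k) i)
    have hS₂ : 0 ≤ ∑ k ∈ Icc 1 ⌊Y⌋₊, |a₂ k| * ellp Y k ^ j :=
      Finset.sum_nonneg fun k _ ↦ mul_nonneg (abs_nonneg _) (pow_nonneg (ellp_nonneg Y k) j)
    have hLi : 0 ≤ Real.log Y ^ i := pow_nonneg hLY0 i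
    have hLj : 0 ≤ Real.log Y ^ j := pow_nonneg hLY0 j
    have hs0 : 0 ≤ Real.sqrt (2 * α * K₁ * Y) := Real.sqrt_nonneg _
    have hx1 : 1 ≤ 1 + |Real.log (2 * α * Y ^ 2)| := by linarith [abs_nonneg (Real.log (2 * α * Y ^ 2))]
    rcases hRR with h | h | h | h | h | h | h | h | h | h | h | h | h | h | h | h | h | h | h | h | h | h | h | h | h
    · exact twoSeq_envelope_mono_pow hS₁ hS₂ hB0 hη0 hLi hLj hs0 hx1 hC₀a ea (by norm_num)
        (hTa R (Or.inl h) a₁ a₂ Y α B η K₁ i j hY hα hi hj hcol hrow hY₁)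
    · exact twoSeq_envelope_mono_pow hS₁ hS₂ hB0 hη0 hLi hLj hs0 hx1 hC₀a ea (by norm_num)
        (hTa R (Or.inr (Or.inl h)) a₁ a₂ Y α B η K₁ i j hY hα hi hj hcol hrow hY₁)
    · exact twoSeq_envelope_mono_pow hS₁ hS₂ hB0 hη0 hLi hLj hs0 hx1 hC₀a ea (by norm_num)
        (hTa R (Or.inr (Or.inr (Or.inl h))) a₁ a₂ Y α B η K₁ i j hY hα hi hj hcol hrow hY₁)
    · exact twoSeq_envelope_mono_pow hS₁ hS₂ hB0 hη0 hLi hLj hs0 hx1 hC₀n en le_rfl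
        (hTn R (Or.inl h) a₁ a₂ Y α B η K₁ i j hY hα hi hj hcol hrow hY₁)
    · exact twoSeq_envelope_mono_pow hS₁ hS₂ hB0 hη0 hLi hLj hs0 hx1 hC₀n en le_rfl
        (hTn R (Or.inr (Or.inr (Or.inr (Or.inr (Or.inl h))))) a₁ a₂ Y α B η K₁ i j hY hα hi hj hcol hrow hY₁)
    · exact twoSeq_envelope_mono_pow hS₁ hS₂ hB0 hη0 hLi hLj hs0 hx1 hC₀a ea (by norm_num)
        (hTa R (Or.inr (Or.inr (Or.inr (Or.inr (Or.inl h))))) a₁ a₂ Y α B η K₁ i j hY hα hi hj hcol hrow hY₁)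
    · exact twoSeq_envelope_mono_pow hS₁ hS₂ hB0 hη0 hLi hLj hs0 hx1 hC₀a ea (by norm_num)
        (hTa R (Or.inr (Or.inr (Or.inr (Or.inr (Or.inr (Or.inl h)))))) a₁ a₂ Y α B η K₁ i j hY hα hi hj hcol hrow hY₁)
    · exact twoSeq_envelope_mono_pow hS₁ hS₂ hB0 hη0 hLi hLj hs0 hx1 hC₀n en le_rfl
        (hTn R (Or.inr (Or.inl h)) a₁ a₂ Y α B η K₁ i j hY hα hi hj hcol hrow hY₁)
    · exact twoSeq_envelope_mono_pow hS₁ hS₂ hB0 hη0 hLi hLj hs0 hx1 hC₀n en le_rfl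
        (hTn R (Or.inr (Or.inr (Or.inr (Or.inr (Or.inr (Or.inl h)))))) a₁ a₂ Y α B η K₁ i j hY hα hi hj hcol hrow hY₁)
    · subst h
      exact twoSeq_envelope_mono_pow hS₁ hS₂ hB0 hη0 hLi hLj hs0 hx1 hC₀c ec (by norm_num)
        (hTc a₁ a₂ Y α B η K₁ i j hY hα hi hj hcol hrow hY₁).1
    · exact twoSeq_envelope_mono_pow hS₁ hS₂ hB0 hη0 hLi hLj hs0 hx1 hC₀a ea (by norm_num)
        (hTa R (Or.inr (Or.inr (Or.inr (Or.inr (Or.inr (Or.inr (Or.inr (Or.inr (Or.inl h))))))))) a₁ a₂ Y α B η K₁ i j hY hα hi hj hcol hrow hY₁)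
    · exact twoSeq_envelope_mono_pow hS₁ hS₂ hB0 hη0 hLi hLj hs0 hx1 hC₀n en le_rfl
        (hTn R (Or.inr (Or.inr (Or.inl h))) a₁ a₂ Y α B η K₁ i j hY hα hi hj hcol hrow hY₁)
    · exact twoSeq_envelope_mono_pow hS₁ hS₂ hB0 hη0 hLi hLj hs0 hx1 hC₀n en le_rfl
        (hTn R (Or.inr (Or.inr (Or.inr (Or.inr (Or.inr (Or.inr (Or.inl h))))))) a₁ a₂ Y α B η K₁ i j hY hα hi hj hcol hrow hY₁)
    · exact twoSeq_envelope_mono_pow hS₁ hS₂ hB0 hη0 hLi hLj hs0 hx1 hC₀a ea (by norm_num)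
        (hTa R (Or.inr (Or.inr (Or.inr (Or.inr (Or.inr (Or.inr (Or.inr (Or.inr (Or.inr (Or.inr (Or.inr (Or.inl h)))))))))))) a₁ a₂ Y α B η K₁ i j hY hα hi hj hcol hrow hY₁)
    · subst h
      exact twoSeq_envelope_mono_pow hS₁ hS₂ hB0 hη0 hLi hLj hs0 hx1 hC₀c ec (by norm_num)
        (hTc a₁ a₂ Y α B η K₁ i j hY hα hi hj hcol hrow hY₁).2
    · exact twoSeq_envelope_mono_pow hS₁ hS₂ hB0 hη0 hLi hLj hs0 hx1 hC₀n en le_rfl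
        (hTn R (Or.inr (Or.inr (Or.inr (Or.inl h)))) a₁ a₂ Y α B η K₁ i j hY hα hi hj hcol hrow hY₁)
    · exact twoSeq_envelope_mono_pow hS₁ hS₂ hB0 hη0 hLi hLj hs0 hx1 hC₀n en le_rfl
        (hTn R (Or.inr (Or.inr (Or.inr (Or.inr (Or.inr (Or.inr (Or.inr (Or.inl h)))))))) a₁ a₂ Y α B η K₁ i j hY hα hi hj hcol hrow hY₁)
    · exact twoSeq_envelope_mono_pow hS₁ hS₂ hB0 hη0 hLi hLj hs0 hx1 hC₀a ea (by norm_num)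
        (hTa R (Or.inr (Or.inr (Or.inr (Or.inr (Or.inr (Or.inr (Or.inr (Or.inr (Or.inr (Or.inr (Or.inr (Or.inr (Or.inr (Or.inr (Or.inl h))))))))))))))) a₁ a₂ Y α B η K₁ i j hY hα hi hj hcol hrow hY₁)
    · exact twoSeq_envelope_mono_pow hS₁ hS₂ hB0 hη0 hLi hLj hs0 hx1 hC₀a ea (by norm_num)
        (hTa R (Or.inr (Or.inr (Or.inr (Or.inr (Or.inr (Or.inr (Or.inr (Or.inr (Or.inr (Or.inr (Or.inr (Or.inr (Or.inr (Or.inr (Or.inr (h)))))))))))))))) a₁ a₂ Y α B η K₁ i j hY hα hi hj hcol hrow hY₁)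
    · subst h
      exact twoSeq_envelope_mono_pow hS₁ hS₂ hB0 hη0 hLi hLj hs0 hx1 hC₀d ed le_rfl
        (hTd a₁ a₂ Y α B η K₁ i j hY hα hi hj hcol hrow hY₁).1
    · exact twoSeq_envelope_mono_pow hS₁ hS₂ hB0 hη0 hLi hLj hs0 hx1 hC₀n en le_rfl
        (hTn R (Or.inr (Or.inr (Or.inr (Or.inr (Or.inr (Or.inr (Or.inr (Or.inr (h))))))))) a₁ a₂ Y α B η K₁ i j hY hα hi hj hcol hrow hY₁)
    · subst h
      exact twoSeq_envelope_mono_pow hS₁ hS₂ hB0 hη0 hLi hLj hs0 hx1 hC₀d ed le_rfl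
        (hTd a₁ a₂ Y α B η K₁ i j hY hα hi hj hcol hrow hY₁).2.2.1
    · subst h
      exact twoSeq_envelope_mono_pow hS₁ hS₂ hB0 hη0 hLi hLj hs0 hx1 hC₀d ed le_rfl
        (hTd a₁ a₂ Y α B η K₁ i j hY hα hi hj hcol hrow hY₁).2.2.2.1
    · subst h
      exact twoSeq_envelope_mono_pow hS₁ hS₂ hB0 hη0 hLi hLj hs0 hx1 hC₀d ed le_rfl
        (hTd a₁ a₂ Y α B η K₁ i j hY hα hi hj hcol hrow hY₁).2.2.2.2.1
    · subst h
      exact twoSeq_envelope_mono_pow hS₁ hS₂ hB0 hη0 hLi hLj hs0 hx1 hC₀d ed le_rfl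
        (hTd a₁ a₂ Y α B η K₁ i j hY hα hi hj hcol hrow hY₁).2.2.2.2.2
  · intro R hRR
    rcases hRR with h | h | h | h | h | h | h | h | h | h | h | h | h | h | h
    · obtain ⟨h1, h2⟩ := hPWa R (Or.inl h)
      exact ⟨fun y hy0 hy1 ↦ (h1 y hy0 hy1).trans (mul_le_mul_of_nonneg_right ea (Real.sqrt_nonneg y)),
        fun y hy ↦ (h2 y hy).trans ((mul_le_mul_of_nonneg_right ea (pow_nonneg (by linarith [Real.log_nonneg hy]) _)).trans
          (mul_le_mul_of_nonneg_left (pow_le_pow_right₀ (by linarith [Real.log_nonneg hy]) (by norm_num)) hC₀))⟩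
    · obtain ⟨h1, h2⟩ := hPWa R (Or.inr (Or.inl h))
      exact ⟨fun y hy0 hy1 ↦ (h1 y hy0 hy1).trans (mul_le_mul_of_nonneg_right ea (Real.sqrt_nonneg y)),
        fun y hy ↦ (h2 y hy).trans ((mul_le_mul_of_nonneg_right ea (pow_nonneg (by linarith [Real.log_nonneg hy]) _)).trans
          (mul_le_mul_of_nonneg_left (pow_le_pow_right₀ (by linarith [Real.log_nonneg hy]) (by norm_num)) hC₀))⟩
    · obtain ⟨h1, h2⟩ := hPWa R (Or.inr (Or.inr (Or.inr (Or.inl h))))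
      exact ⟨fun y hy0 hy1 ↦ (h1 y hy0 hy1).trans (mul_le_mul_of_nonneg_right ea (Real.sqrt_nonneg y)),
        fun y hy ↦ (h2 y hy).trans ((mul_le_mul_of_nonneg_right ea (pow_nonneg (by linarith [Real.log_nonneg hy]) _)).trans
          (mul_le_mul_of_nonneg_left (pow_le_pow_right₀ (by linarith [Real.log_nonneg hy]) (by norm_num)) hC₀))⟩
    · obtain ⟨h1, h2⟩ := hPWn R (Or.inl h)
      exact ⟨fun y hy0 hy1 ↦ (h1 y hy0 hy1).trans (mul_le_mul_of_nonneg_right en (Real.sqrt_nonneg y)),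
        fun y hy ↦ (h2 y hy).trans (mul_le_mul_of_nonneg_right en (pow_nonneg (by linarith [Real.log_nonneg hy]) _))⟩
    · obtain ⟨h1, h2⟩ := hPWn R (Or.inr (Or.inr (Or.inr (Or.inr (Or.inl h)))))
      exact ⟨fun y hy0 hy1 ↦ (h1 y hy0 hy1).trans (mul_le_mul_of_nonneg_right en (Real.sqrt_nonneg y)),
        fun y hy ↦ (h2 y hy).trans (mul_le_mul_of_nonneg_right en (pow_nonneg (by linarith [Real.log_nonneg hy]) _))⟩
    · obtain ⟨h1, h2⟩ := hPWa R (Or.inr (Or.inr (Or.inl h)))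
      exact ⟨fun y hy0 hy1 ↦ (h1 y hy0 hy1).trans (mul_le_mul_of_nonneg_right ea (Real.sqrt_nonneg y)),
        fun y hy ↦ (h2 y hy).trans ((mul_le_mul_of_nonneg_right ea (pow_nonneg (by linarith [Real.log_nonneg hy]) _)).trans
          (mul_le_mul_of_nonneg_left (pow_le_pow_right₀ (by linarith [Real.log_nonneg hy]) (by norm_num)) hC₀))⟩
    · obtain ⟨h1, h2⟩ := hPWa R (Or.inr (Or.inr (Or.inr (Or.inr (Or.inr (h))))))
      exact ⟨fun y hy0 hy1 ↦ (h1 y hy0 hy1).trans (mul_le_mul_of_nonneg_right ea (Real.sqrt_nonneg y)),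
        fun y hy ↦ (h2 y hy).trans ((mul_le_mul_of_nonneg_right ea (pow_nonneg (by linarith [Real.log_nonneg hy]) _)).trans
          (mul_le_mul_of_nonneg_left (pow_le_pow_right₀ (by linarith [Real.log_nonneg hy]) (by norm_num)) hC₀))⟩
    · obtain ⟨h1, h2⟩ := hPWn R (Or.inr (Or.inl h))
      exact ⟨fun y hy0 hy1 ↦ (h1 y hy0 hy1).trans (mul_le_mul_of_nonneg_right en (Real.sqrt_nonneg y)),
        fun y hy ↦ (h2 y hy).trans (mul_le_mul_of_nonneg_right en (pow_nonneg (by linarith [Real.log_nonneg hy]) _))⟩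
    · obtain ⟨h1, h2⟩ := hPWn R (Or.inr (Or.inr (Or.inr (Or.inr (Or.inr (Or.inl h))))))
      exact ⟨fun y hy0 hy1 ↦ (h1 y hy0 hy1).trans (mul_le_mul_of_nonneg_right en (Real.sqrt_nonneg y)),
        fun y hy ↦ (h2 y hy).trans (mul_le_mul_of_nonneg_right en (pow_nonneg (by linarith [Real.log_nonneg hy]) _))⟩
    · obtain ⟨h1, h2⟩ := hPWa R (Or.inr (Or.inr (Or.inr (Or.inr (Or.inl h)))))
      exact ⟨fun y hy0 hy1 ↦ (h1 y hy0 hy1).trans (mul_le_mul_of_nonneg_right ea (Real.sqrt_nonneg y)),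
        fun y hy ↦ (h2 y hy).trans ((mul_le_mul_of_nonneg_right ea (pow_nonneg (by linarith [Real.log_nonneg hy]) _)).trans
          (mul_le_mul_of_nonneg_left (pow_le_pow_right₀ (by linarith [Real.log_nonneg hy]) (by norm_num)) hC₀))⟩
    · obtain ⟨h1, h2⟩ := hPWn R (Or.inr (Or.inr (Or.inl h)))
      exact ⟨fun y hy0 hy1 ↦ (h1 y hy0 hy1).trans (mul_le_mul_of_nonneg_right en (Real.sqrt_nonneg y)),
        fun y hy ↦ (h2 y hy).trans (mul_le_mul_of_nonneg_right en (pow_nonneg (by linarith [Real.log_nonneg hy]) _))⟩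
    · obtain ⟨h1, h2⟩ := hPWn R (Or.inr (Or.inr (Or.inr (Or.inr (Or.inr (Or.inr (Or.inl h)))))))
      exact ⟨fun y hy0 hy1 ↦ (h1 y hy0 hy1).trans (mul_le_mul_of_nonneg_right en (Real.sqrt_nonneg y)),
        fun y hy ↦ (h2 y hy).trans (mul_le_mul_of_nonneg_right en (pow_nonneg (by linarith [Real.log_nonneg hy]) _))⟩
    · obtain ⟨h1, h2⟩ := hPWn R (Or.inr (Or.inr (Or.inr (Or.inl h))))
      exact ⟨fun y hy0 hy1 ↦ (h1 y hy0 hy1).trans (mul_le_mul_of_nonneg_right en (Real.sqrt_nonneg y)),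
        fun y hy ↦ (h2 y hy).trans (mul_le_mul_of_nonneg_right en (pow_nonneg (by linarith [Real.log_nonneg hy]) _))⟩
    · obtain ⟨h1, h2⟩ := hPWn R (Or.inr (Or.inr (Or.inr (Or.inr (Or.inr (Or.inr (Or.inr (Or.inl h))))))))
      exact ⟨fun y hy0 hy1 ↦ (h1 y hy0 hy1).trans (mul_le_mul_of_nonneg_right en (Real.sqrt_nonneg y)),
        fun y hy ↦ (h2 y hy).trans (mul_le_mul_of_nonneg_right en (pow_nonneg (by linarith [Real.log_nonneg hy]) _))⟩
    · obtain ⟨h1, h2⟩ := hPWn R (Or.inr (Or.inr (Or.inr (Or.inr (Or.inr (Or.inr (Or.inr (Or.inr (h)))))))))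
      exact ⟨fun y hy0 hy1 ↦ (h1 y hy0 hy1).trans (mul_le_mul_of_nonneg_right en (Real.sqrt_nonneg y)),
        fun y hy ↦ (h2 y hy).trans (mul_le_mul_of_nonneg_right en (pow_nonneg (by linarith [Real.log_nonneg hy]) _))⟩

end Summit.Parity.GeneralizedHardyLittlewood.Theorems.MomentsBeyondDiagonal.DiagCorner

end
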